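import Literature.NumberTheory.Automorphic.UnitaryGroupStableOrbitalIntegral
import HarnessLib

/-!
# The orbital terms of the anisotropic inner form `U(H)` are INTEGRABLE weighted global orbital integrals,
# hence ADDITIVE in the test function: `J(𝒪_st, F + G) = J(𝒪_st, F) + J(𝒪_st, G)`
(Rogawski, *Automorphic representations of unitary groups in three variables* (1990), §14.5 p. 237 (print):
`J_{G′}(f′) = Σ_γ a_γ Φ(γ, f′)` — a DISTRIBUTION in `f′`; §5.4 p. 71: `Φ(γ, f) = ∫_{G_γ(𝔸)\G(𝔸)} f(g⁻¹ γ g) dg`)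

Topic `NumberTheory/Automorphic`; namespace `Literature.NumberTheory.Automorphic.UnitaryGroup`; THEOREMS ONLY (no def, no
instance, no named fact, no `sorry`), on top of ★ `UnitaryGroupStableOrbitalIntegral` (T1b-3: `adelicClassOrbitalIntegral`,
`AdelicOrbitalMeasureFamily`, the bridge) and ★ `UnitaryGroupDiagTraceExpansion`.

★ `diagTrace_eq_const_mul_tsum_orbital` RECORDS that every orbital integrand `y ↦ F(y γ y⁻¹)`, `F ∈ C_c(U(H)(𝔸_{L⁺}))`, is
integrable for the genuine orbital measures of the geometric side (compact quotient: absolute convergence of the unfolding) —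
but the downstream packagings (`_sum_orbital`, …, ★ `IsOrbitalTerms`) drop it, so the line's `J(𝒪_st, ·)` is so far only known to
be homogeneous.  This file re-runs the rational re-indexing (★ `exists_finset_descConj_eq_zero_cmDatum`, the class bijection
`U(H)(L⁺) ≃* im(toAdelic)`) and the transport of T1b-3's bridge (conjugate representatives, ★ `cosetCongr (conj q⁻¹)`,
invariance) KEEPING integrability:

* `exists_integrable_diagTrace_eq_finsum_adelicClassOrbitalIntegral` — for `H` anisotropic there are `C > 0`, weights
  `w[γ] > 0` and a rational-class-indexed family `μ` of non-zero invariant measures finite on compact sets (Borel σ-algebras)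
  such that for EVERY `F ∈ C_c`: every orbital integrand `descConj (toAdelic γ_c) … ⇑F` is `μ_[γ]`-INTEGRABLE, the class function
  `[γ] ↦ C · w[γ] · Φ(γ, F)` is finitely supported, and `θ_{G′}(F) = Σᶠ_{[γ]} C · w[γ] · Φ(γ, F) = Σᶠ_{𝒪_st} 𝒪_st.orbitalSum (…)`;
* `adelicClassOrbitalIntegral_add_of_integrable` ∕ `orbitalSum_weighted_add` — consequently the genuine orbital terms and their
  stable groupings are ADDITIVE in `F` (with ★ `_smul`: ℂ-linear) — the J-side half of a LINEARITY law for the floor-0 kit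
  (the `f′ ↦ f` half is ★ `UnitaryGroupTransferAwaySpan`).

## References
* J. D. Rogawski, *Automorphic Representations of Unitary Groups in Three Variables*, Ann. of Math. Stud. 123 (1990),
  §5.4 p. 71, §14.5 p. 237 (print) [Rogawski1990].
* S. Gelbart, *Automorphic forms on adele groups*, Ann. of Math. Stud. 83 (1975), (9.13), Remark 9.23 [Gelbart1975].
-/

noncomputable section

open MeasureTheory Measure Set Filter Topology NumberField CompactlySupported
open Literature.MeasureTheory.Group
open scoped ENNReal NNReal Pointwise

namespace Literature.NumberTheory.Automorphic

namespace UnitaryGroup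

open Literature.NumberTheory.Rogawski1990
open Literature.AlgebraicGeometry.ShimuraVarieties (hermForm)

/-! ### Additivity of the orbital terms in the test function -/

section Additive

variable {L : Type} [Field L] [NumberField L] [IsCMField L] {N : ℕ} {H : Matrix (Fin N) (Fin N) L}
  [∀ g : (cmDatum L N H).Adelic,
    MeasurableSpace ((cmDatum L N H).Adelic ⧸ Subgroup.centralizer ({g} : Set (cmDatum L N H).Adelic))]

/-- **`Φ(γ, F + G) = Φ(γ, F) + Φ(γ, G)` for all classes at once**, given integrability of the orbital integrands of `F` and `G`
(as delivered by `exists_integrable_diagTrace_eq_finsum_adelicClassOrbitalIntegral`). [cite: Rogawski1990, §14.5 p. 237] -/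
theorem adelicClassOrbitalIntegral_add_of_integrable (μ : AdelicOrbitalMeasureFamily L N H) {F G : (cmDatum L N H).Adelic → ℂ}
    (hF : ∀ c, Integrable (descConj ((cmDatum L N H).toAdelic (Quotient.out c))
      (Subgroup.centralizer ({(cmDatum L N H).toAdelic (Quotient.out c)} : Set (cmDatum L N H).Adelic))
      (fun _ hg => Subgroup.mem_centralizer_singleton_iff.1 hg) F) (μ c))
    (hG : ∀ c, Integrable (descConj ((cmDatum L N H).toAdelic (Quotient.out c))
      (Subgroup.centralizer ({(cmDatum L N H).toAdelic (Quotient.out c)} : Set (cmDatum L N H).Adelic))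
      (fun _ hg => Subgroup.mem_centralizer_singleton_iff.1 hg) G) (μ c)) :
    adelicClassOrbitalIntegral L N H μ (F + G) = adelicClassOrbitalIntegral L N H μ F + adelicClassOrbitalIntegral L N H μ G :=
  funext fun c => classOrbitalIntegralAlong_add _ μ c (hF c) (hG c)

/-- **The weighted orbital terms `[γ] ↦ C · w[γ] · Φ(γ, ·)` are additive** under the same integrability. [cite: Rogawski1990, §14.5 p. 237] -/
theorem weighted_adelicClassOrbitalIntegral_add_of_integrable (μ : AdelicOrbitalMeasureFamily L N H)
    (a : ConjClasses (cmDatum L N H).Rational → ℂ) {F G : (cmDatum L N H).Adelic → ℂ}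
    (hF : ∀ c, Integrable (descConj ((cmDatum L N H).toAdelic (Quotient.out c))
      (Subgroup.centralizer ({(cmDatum L N H).toAdelic (Quotient.out c)} : Set (cmDatum L N H).Adelic))
      (fun _ hg => Subgroup.mem_centralizer_singleton_iff.1 hg) F) (μ c))
    (hG : ∀ c, Integrable (descConj ((cmDatum L N H).toAdelic (Quotient.out c))
      (Subgroup.centralizer ({(cmDatum L N H).toAdelic (Quotient.out c)} : Set (cmDatum L N H).Adelic))
      (fun _ hg => Subgroup.mem_centralizer_singleton_iff.1 hg) G) (μ c)) :
    (fun c => a c * adelicClassOrbitalIntegral L N H μ (F + G) c) =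
      (fun c => a c * adelicClassOrbitalIntegral L N H μ F c) + fun c => a c * adelicClassOrbitalIntegral L N H μ G c := by
  funext c
  rw [Pi.add_apply, adelicClassOrbitalIntegral_add_of_integrable μ hF hG, Pi.add_apply, mul_add]

/-- **`J(𝒪_st, F + G) = J(𝒪_st, F) + J(𝒪_st, G)`**: stable orbital sums of finitely supported class functions are additive
(`finsum_mem_add_distrib`). [cite: Rogawski1990, §14.5 p. 237] -/
theorem _root_.Literature.NumberTheory.Rogawski1990.StableClass.orbitalSum_add {R : Type*} [CommRing R] {n : Type*} [Fintype n]
    [DecidableEq n] {σ : R →+* R} {H₀ : Matrix n n R} {S : Type*} [CommRing S]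
    (Φ Ψ : ConjClasses (Literature.AlgebraicGeometry.ShimuraVarieties.unitaryGroup σ H₀) → S)
    (hΦ : (Function.support Φ).Finite) (hΨ : (Function.support Ψ).Finite) (st : StableClass σ H₀) :
    st.orbitalSum (Φ + Ψ) = st.orbitalSum Φ + st.orbitalSum Ψ := by
  obtain ⟨γ, rfl⟩ := stableClassOf_surjective st
  simp only [StableClass.orbitalSum_stableClassOf, stableOrbitalSum]
  simp only [Pi.add_apply]
  exact finsum_mem_add_distrib' (hΦ.subset Set.inter_subset_right) (hΨ.subset Set.inter_subset_right)

end Additive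

/-! ### The integrable orbital expansion -/

section Integrable

variable (L : Type) [Field L] [NumberField L] [IsCMField L] (N : ℕ) (H : Matrix (Fin N) (Fin N) L)
  [MeasurableSpace (cmDatum L N H).Adelic] [BorelSpace (cmDatum L N H).Adelic]
  [∀ γ : (cmDatum L N H).Adelic, MeasurableSpace ((cmDatum L N H).Adelic ⧸
    Subgroup.centralizer ({γ} : Set (cmDatum L N H).Adelic))]
  [∀ γ : (cmDatum L N H).Adelic, BorelSpace ((cmDatum L N H).Adelic ⧸
    Subgroup.centralizer ({γ} : Set (cmDatum L N H).Adelic))]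
  (μA : Measure (cmDatum L N H).automorphicQuotient) [(cmDatum L N H).IsAutomorphicMeasure μA]
  (ν : Measure (cmDatum L N H).Adelic) [ν.IsHaarMeasure]

/-- **`θ_{G′}(F) = Σᶠ_{[γ]} C · w[γ] · Φ(γ, F)` with INTEGRABLE orbital integrands** (anisotropic `H`, `μA` automorphic, `ν` Haar;
any Borel-structure instances on the orbit spaces): there are `C > 0`, `w[γ] > 0` and a rational-class-indexed family `μ` of non-zero
`U(H)(𝔸)`-invariant measures finite on compact sets such that for every `F ∈ C_c(U(H)(𝔸_{L⁺}))` (i) every orbital integrand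
`y ↦ F(y γ_c y⁻¹)` (`γ_c = toAdelic (out [γ])`) is `μ_[γ]`-integrable, (ii) `[γ] ↦ C · w[γ] · Φ(γ, F)` is finitely supported, and
(iii) `UnitaryGroup.diagTrace … F = Σᶠ_{[γ]} C · w[γ] · adelicClassOrbitalIntegral μ F [γ]`.  (★ `diagTrace_eq_const_mul_tsum_orbital`
re-indexed by the rational classes and transported to the representatives `toAdelic (out [γ])`, keeping its integrability clause.)
[cite: Rogawski1990, §14.5 p. 237] -/
theorem exists_integrable_diagTrace_eq_finsum_adelicClassOrbitalIntegral
    (hanis : ∀ x : Fin N → L, hermForm (cmConjRingHom L) H x x = 0 → x = 0) :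
    ∃ (C : ℝ≥0) (w : ConjClasses (cmDatum L N H).Rational → ℝ≥0) (μ : AdelicOrbitalMeasureFamily L N H),
      0 < C ∧ (∀ c, w c ≠ 0) ∧
      (∀ c, SMulInvariantMeasure (cmDatum L N H).Adelic _ (μ c) ∧ IsFiniteMeasureOnCompacts (μ c) ∧ μ c ≠ 0) ∧
      ∀ F : C_c((cmDatum L N H).Adelic, ℂ),
        (∀ c, Integrable (descConj ((cmDatum L N H).toAdelic (Quotient.out c))
          (Subgroup.centralizer ({(cmDatum L N H).toAdelic (Quotient.out c)} : Set (cmDatum L N H).Adelic))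
          (fun _ hg => Subgroup.mem_centralizer_singleton_iff.1 hg) (⇑F)) (μ c)) ∧
        (Function.support fun c => ((C : ℝ) : ℂ) * ((w c : ℝ) : ℂ) * adelicClassOrbitalIntegral L N H μ F c).Finite ∧
        diagTrace L N H μA ν hanis F =
          ∑ᶠ c, ((C : ℝ) : ℂ) * ((w c : ℝ) : ℂ) * adelicClassOrbitalIntegral L N H μ F c := by
  classical
  -- the geometric side with its integrability clause, indexed by the classes of the arithmetic subgroup
  obtain ⟨C, dc, μC, hC, hdc, hμC, hF⟩ := diagTrace_eq_const_mul_tsum_orbital L N H μA ν hanis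
  -- the class bijection `e` induced by `U(H)(L⁺) ≃* im(toAdelic)`
  obtain ⟨ι, hι⟩ : ∃ ι : (cmDatum L N H).Rational ≃* (cmDatum L N H).arithmeticSubgroup,
      ∀ γ, ((ι γ : (cmDatum L N H).arithmeticSubgroup) : (cmDatum L N H).Adelic) = (cmDatum L N H).toAdelic γ :=
    ⟨MonoidHom.ofInjective (cmDatum_toAdelic_injective L N H), fun _ => rfl⟩
  have hbij := Literature.NumberTheory.Rogawski1990.bijective_conjClassesMap_of_mulEquiv ι
  set e : ConjClasses (cmDatum L N H).Rational ≃ ConjClasses (cmDatum L N H).arithmeticSubgroup :=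
    Equiv.ofBijective _ hbij with he_def
  have he : ∀ γ : (cmDatum L N H).Rational, e (ConjClasses.mk γ) =
      ConjClasses.mk ⟨(cmDatum L N H).toAdelic γ, ⟨γ, rfl⟩⟩ := fun γ => by
    show ConjClasses.mk (ι.toMonoidHom γ) = _
    exact congrArg ConjClasses.mk (Subtype.ext (hι γ))
  -- representatives: mine `γr c = toAdelic (out c)`, the geometric side's `γa c = out (e c)`; they are conjugate
  let γr : ConjClasses (cmDatum L N H).Rational → (cmDatum L N H).Adelic := fun c => (cmDatum L N H).toAdelic (Quotient.out c)
  let γa : ConjClasses (cmDatum L N H).Rational → (cmDatum L N H).Adelic := fun c =>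
    ((Quotient.out (e c) : (cmDatum L N H).arithmeticSubgroup) : (cmDatum L N H).Adelic)
  have hconj : ∀ c, ∃ q : (cmDatum L N H).Adelic, q * γr c * q⁻¹ = γa c := by
    intro c
    have h1 : e c = ConjClasses.mk (⟨(cmDatum L N H).toAdelic (Quotient.out c), ⟨Quotient.out c, rfl⟩⟩ :
        (cmDatum L N H).arithmeticSubgroup) := by
      conv_lhs => rw [← Quotient.out_eq c]
      exact he (Quotient.out c)
    have h2 : ConjClasses.mk (Quotient.out (e c)) = e c := Quotient.out_eq _
    have h3 : IsConj (⟨(cmDatum L N H).toAdelic (Quotient.out c), ⟨Quotient.out c, rfl⟩⟩ :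
        (cmDatum L N H).arithmeticSubgroup) (Quotient.out (e c)) :=
      ConjClasses.mk_eq_mk_iff_isConj.mp (h1.symm.trans h2.symm)
    obtain ⟨u, hu⟩ := isConj_iff.mp h3
    refine ⟨(u : (cmDatum L N H).Adelic), ?_⟩
    have := congrArg (fun z : (cmDatum L N H).arithmeticSubgroup => (z : (cmDatum L N H).Adelic)) hu
    simpa only [Subgroup.coe_mul, Subgroup.coe_inv] using this
  choose q hq using hconj
  have hq' : ∀ c, (MulAut.conj (q c)⁻¹) (γa c) = γr c := fun c => by
    rw [MulAut.conj_apply, ← hq c]; group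
  have hcont : ∀ x : (cmDatum L N H).Adelic, Continuous (MulAut.conj x) := fun x => (continuous_const.mul continuous_id).mul continuous_const
  have hcont' : ∀ x : (cmDatum L N H).Adelic, Continuous (MulAut.conj x).symm := fun x => (continuous_const.mul continuous_id).mul continuous_const
  -- transported measures (along `conj (q c)⁻¹ : γa c ↦ γr c`)
  let ψ : ∀ c, (cmDatum L N H).Adelic ⧸ Subgroup.centralizer ({γa c} : Set (cmDatum L N H).Adelic) →
      (cmDatum L N H).Adelic ⧸ Subgroup.centralizer ({γr c} : Set (cmDatum L N H).Adelic) := fun c =>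
    cosetCongr (MulAut.conj (q c)⁻¹) _ _ (forall_apply_mem_centralizer_singleton_iff_of_eq (MulAut.conj (q c)⁻¹) (hq' c))
  let ψh : ∀ c, (cmDatum L N H).Adelic ⧸ Subgroup.centralizer ({γa c} : Set (cmDatum L N H).Adelic) ≃ₜ
      (cmDatum L N H).Adelic ⧸ Subgroup.centralizer ({γr c} : Set (cmDatum L N H).Adelic) := fun c =>
    cosetCongrHomeomorph (MulAut.conj (q c)⁻¹) _ _
      (forall_apply_mem_centralizer_singleton_iff_of_eq (MulAut.conj (q c)⁻¹) (hq' c)) (hcont _) (hcont' _)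
  have hψ : ∀ c, ψ c = ⇑(ψh c) := fun c => rfl
  haveI hμCinv : ∀ c, SMulInvariantMeasure (cmDatum L N H).Adelic _ (μC c) := fun c => (hμC c).1
  haveI hμCfin : ∀ c, IsFiniteMeasureOnCompacts (μC c) := fun c => (hμC c).2.1
  let μ : AdelicOrbitalMeasureFamily L N H := fun c => Measure.map (ψ c) (μC (e c))
  have hμinv : ∀ c, SMulInvariantMeasure (cmDatum L N H).Adelic _ (μ c) := fun c =>
    smulInvariantMeasure_map_cosetCongr_of_smulInvariant (MulAut.conj (q c)⁻¹) (hcont _) _ _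
      (forall_apply_mem_centralizer_singleton_iff_of_eq (MulAut.conj (q c)⁻¹) (hq' c)) (μC (e c))
  have hμfin : ∀ c, IsFiniteMeasureOnCompacts (μ c) := fun c => by
    show IsFiniteMeasureOnCompacts (Measure.map (ψ c) (μC (e c)))
    rw [hψ]
    exact IsFiniteMeasureOnCompacts.map (μC (e c)) (ψh c)
  have hμne : ∀ c, μ c ≠ 0 := fun c => by
    show Measure.map (ψ c) (μC (e c)) ≠ 0
    rw [hψ, Ne, Measure.map_eq_zero_iff (Homeomorph.measurable _).aemeasurable]
    exact (hμC (e c)).2.2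
  -- (i) integrability is transported: `descConj γr F ∘ ψ = (descConj γa F) ∘ (q⁻¹ • ·)`
  have hcomp : ∀ (F : (cmDatum L N H).Adelic → ℂ) c,
      (descConj (γr c) (Subgroup.centralizer ({γr c} : Set (cmDatum L N H).Adelic)) (centralizer_comm (γr c)) F) ∘ (ψ c) =
      (descConj (γa c) (Subgroup.centralizer ({γa c} : Set (cmDatum L N H).Adelic)) (centralizer_comm (γa c)) F) ∘
        (fun x => (q c)⁻¹ • x) := by
    intro F c
    funext x
    rw [Function.comp_apply, Function.comp_apply]
    show descConj (γr c) _ (centralizer_comm (γr c)) F (cosetCongr (MulAut.conj (q c)⁻¹) _ _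
      (forall_apply_mem_centralizer_singleton_iff_of_eq (MulAut.conj (q c)⁻¹) (hq' c)) x) = _
    rw [descConj_cosetCongr_apply (MulAut.conj (q c)⁻¹) (hq' c) F x, descConj_comp_conj_eq_descConj_smul]
  have hInt : ∀ (F : C_c((cmDatum L N H).Adelic, ℂ)) c, Integrable (descConj (γr c) (Subgroup.centralizer ({γr c} : Set (cmDatum L N H).Adelic))
      (fun _ hg => Subgroup.mem_centralizer_singleton_iff.1 hg) (⇑F)) (μ c) := by
    intro F c
    obtain ⟨hIntF, -, -⟩ := hF F
    have h2 : Integrable ((descConj (γa c) (Subgroup.centralizer ({γa c} : Set (cmDatum L N H).Adelic)) (centralizer_comm (γa c)) (⇑F)) ∘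
        (fun x => (q c)⁻¹ • x)) (μC (e c)) :=
      (measurePreserving_smul ((q c)⁻¹) (μC (e c))).integrable_comp_of_integrable (hIntF (e c))
    rw [← hcomp (⇑F) c] at h2
    show Integrable (descConj (γr c) _ (centralizer_comm (γr c)) (⇑F)) (Measure.map (⇑(ψh c).toMeasurableEquiv) (μC (e c)))
    exact (integrable_map_equiv (ψh c).toMeasurableEquiv _).mpr h2
  -- orbital integrals over the conjugate representatives agree up to a constant
  have key : ∀ c, ∃ κ : ℝ≥0, κ ≠ 0 ∧ ∀ F : (cmDatum L N H).Adelic → ℂ,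
      ∫ y, descConj (γa c) (Subgroup.centralizer ({γa c} : Set (cmDatum L N H).Adelic)) (centralizer_comm (γa c)) F y ∂(μC (e c)) =
        κ • ∫ x, descConj (γr c) (Subgroup.centralizer ({γr c} : Set (cmDatum L N H).Adelic)) (centralizer_comm (γr c)) F x ∂(μ c) := by
    intro c
    haveI := hμinv c
    haveI := hμfin c
    exact exists_integral_descConj_eq_smul_integral_descConj_of_conj_eq (q c) (hq c) (μ c) (μC (e c)) (hμne c) (hμC (e c)).2.2
  choose κ hκ0 hκ using key
  -- the per-class identity `C · d_{e c} · ∫ … ∂μC (e c) = C · w c · Φ(γ_c, F)`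
  have hterm : ∀ (F : C_c((cmDatum L N H).Adelic, ℂ)) c, ((C : ℝ) : ℂ) * ((dc (e c)).toReal : ℂ) *
      ∫ y, descConj (γa c) (Subgroup.centralizer ({γa c} : Set (cmDatum L N H).Adelic)) (centralizer_comm (γa c)) F y ∂(μC (e c)) =
      ((C : ℝ) : ℂ) * ((((dc (e c)).toNNReal * κ c : ℝ≥0) : ℝ) : ℂ) * adelicClassOrbitalIntegral L N H μ F c := by
    intro F c
    rw [hκ c F, adelicClassOrbitalIntegral, classOrbitalIntegralAlong_eq, orbitalIntegral_eq_integral_descConj, NNReal.smul_def,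
      Complex.real_smul, ENNReal.toReal, NNReal.coe_mul, Complex.ofReal_mul]
    ring
  refine ⟨C, fun c => (dc (e c)).toNNReal * κ c, μ, hC, fun c => mul_ne_zero ?_ (hκ0 c),
    fun c => ⟨hμinv c, hμfin c, hμne c⟩, fun F => ⟨hInt F, ?_, ?_⟩⟩
  · exact ENNReal.toNNReal_ne_zero.mpr ⟨(hdc (e c)).1, (hdc (e c)).2⟩
  · -- (ii) finite support: off a finite set of arithmetic classes the orbital integrands vanish
    obtain ⟨s, hs⟩ := exists_finset_descConj_eq_zero_cmDatum L N H hanis F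
      (fun c => Subgroup.centralizer ({((Quotient.out c : (cmDatum L N H).arithmeticSubgroup) : (cmDatum L N H).Adelic)} : Set (cmDatum L N H).Adelic))
      (fun c => fun _ hg => Subgroup.mem_centralizer_singleton_iff.1 hg)
    refine (s.finite_toSet.preimage e.injective.injOn).subset fun c hc => ?_
    by_contra hcs
    refine hc ?_
    show ((C : ℝ) : ℂ) * ((((dc (e c)).toNNReal * κ c : ℝ≥0) : ℝ) : ℂ) * adelicClassOrbitalIntegral L N H μ F c = 0
    rw [← hterm F c]
    show ((C : ℝ) : ℂ) * ((dc (e c)).toReal : ℂ) * ∫ y, descConj (γa c) _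
      (fun _ hg => Subgroup.mem_centralizer_singleton_iff.1 hg) F y ∂(μC (e c)) = 0
    rw [hs (e c) hcs, Pi.zero_def, integral_zero, mul_zero]
  · -- (iii) the trace identity: `tsum` over arithmetic classes → `finsum` → rational classes
    obtain ⟨-, -, hEq⟩ := hF F
    obtain ⟨s, hs⟩ := exists_finset_descConj_eq_zero_cmDatum L N H hanis F
      (fun c => Subgroup.centralizer ({((Quotient.out c : (cmDatum L N H).arithmeticSubgroup) : (cmDatum L N H).Adelic)} :
        Set (cmDatum L N H).Adelic))
      (fun c => fun _ hg => Subgroup.mem_centralizer_singleton_iff.1 hg)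
    set T : ConjClasses (cmDatum L N H).arithmeticSubgroup → ℂ := fun c => ((dc c).toReal : ℂ) * ∫ y, descConj
        ((Quotient.out c : (cmDatum L N H).arithmeticSubgroup) : (cmDatum L N H).Adelic)
        (Subgroup.centralizer ({((Quotient.out c : (cmDatum L N H).arithmeticSubgroup) : (cmDatum L N H).Adelic)} :
          Set (cmDatum L N H).Adelic))
        (fun _ hg => Subgroup.mem_centralizer_singleton_iff.1 hg) F y ∂(μC c) with hT
    have hzero : ∀ c ∉ s, T c = 0 := fun c hc => by
      simp only [hT]
      rw [hs c hc, Pi.zero_def, integral_zero, mul_zero]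
    have hsupp : (Function.support fun c => ((C : ℝ) : ℂ) * T c) ⊆ ↑s := fun c hc => by
      by_contra hcs
      simp only [Function.mem_support, ne_eq] at hc
      exact hc (by rw [hzero c (fun h => hcs (Finset.mem_coe.mpr h)), mul_zero])
    have hEq' : diagTrace L N H μA ν hanis F = ∑ᶠ c, ((C : ℝ) : ℂ) * T c := by
      rw [hEq, tsum_eq_sum (s := s) (fun c hc => hzero c hc), Finset.mul_sum, finsum_eq_sum_of_support_subset _ hsupp]
    rw [hEq', ← finsum_comp_equiv e]
    refine finsum_congr fun c => ?_
    show ((C : ℝ) : ℂ) * T (e c) = _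
    simp only [hT]
    rw [← mul_assoc]
    exact hterm F c

/-- **Stable grouping of the integrable orbital terms**: with the same data, `𝒪_st ↦ 𝒪_st.orbitalSum ([γ] ↦ C · w[γ] · Φ(γ, F))` is
finitely supported and `θ_{G′}(F) = Σᶠ_{𝒪_st} 𝒪_st.orbitalSum (…)` (★ `finsum_stableClass_orbitalSum`) — the T1a law with
INTEGRABLE genuine terms. [cite: Rogawski1990, §14.5 p. 237] -/
theorem exists_integrable_diagTrace_eq_finsum_orbitalSum
    (hanis : ∀ x : Fin N → L, hermForm (cmConjRingHom L) H x x = 0 → x = 0) :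
    ∃ (C : ℝ≥0) (w : ConjClasses (cmDatum L N H).Rational → ℝ≥0) (μ : AdelicOrbitalMeasureFamily L N H),
      0 < C ∧ (∀ c, w c ≠ 0) ∧
      (∀ c, SMulInvariantMeasure (cmDatum L N H).Adelic _ (μ c) ∧ IsFiniteMeasureOnCompacts (μ c) ∧ μ c ≠ 0) ∧
      ∀ F : C_c((cmDatum L N H).Adelic, ℂ),
        (∀ c, Integrable (descConj ((cmDatum L N H).toAdelic (Quotient.out c))
          (Subgroup.centralizer ({(cmDatum L N H).toAdelic (Quotient.out c)} : Set (cmDatum L N H).Adelic))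
          (fun _ hg => Subgroup.mem_centralizer_singleton_iff.1 hg) (⇑F)) (μ c)) ∧
        (Function.support fun c => ((C : ℝ) : ℂ) * ((w c : ℝ) : ℂ) * adelicClassOrbitalIntegral L N H μ F c).Finite ∧
        (Function.support fun st : StableClass (cmConjRingHom L) H =>
          st.orbitalSum fun c => ((C : ℝ) : ℂ) * ((w c : ℝ) : ℂ) * adelicClassOrbitalIntegral L N H μ F c).Finite ∧
        diagTrace L N H μA ν hanis F =
          ∑ᶠ st : StableClass (cmConjRingHom L) H,
            st.orbitalSum fun c => ((C : ℝ) : ℂ) * ((w c : ℝ) : ℂ) * adelicClassOrbitalIntegral L N H μ F c := by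
  obtain ⟨C, w, μ, hC, hw, hμ, hF⟩ := exists_integrable_diagTrace_eq_finsum_adelicClassOrbitalIntegral L N H μA ν hanis
  refine ⟨C, w, μ, hC, hw, hμ, fun F => ?_⟩
  obtain ⟨hInt, hfin, hEq⟩ := hF F
  refine ⟨hInt, hfin, StableClass.finite_support_orbitalSum _ hfin, ?_⟩
  rw [hEq]
  exact (finsum_stableClass_orbitalSum _ hfin).symm

end Integrable

end UnitaryGroup

end Literature.NumberTheory.Automorphic
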